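import Summits.AtomisticToContinuum.HydrodynamicLimit.Theses.JParityClosure
import Summits.AtomisticToContinuum.HydrodynamicLimit.Theses.ImplosionDichotomy
import Summits.AtomisticToContinuum.HydrodynamicLimit.Theorems.DensityCap.Negative.MollifiedDensity
import Literature.Analysis.FluidPDE.HardSphereDynamicsProofs
import Literature.Analysis.FluidPDE.HardSphereRegularGeometry
import HarnessLib.Audit

/-!
# Line `lipschitz-clock-free-past-cap` — crux `JParityClosure.DensityCap` (stmt-AtomisticToContinuum-13082)

LEAD RESHAPE v1 (prover-line-stmt-AtomisticToContinuum-13082-0, 2026-08-16) of the crux-plan skeleton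
(planner-cruxplan-stmt-AtomisticToContinuum-13082-lipschitz-clock-free-0) of the idea card
`Cruxes/DensityCap/Ideas/lipschitz-clock-free-past-cap.md` (triage r1: pass ×3). For THIS crux the line is the DOCK —
`DensityCap` is the density third of the conjunct's conclusion, uniformly in `(s, x)`, and it follows from the fixed-time
density law of large numbers at every `s ≤ t` by the card's LIPSCHITZ CLOCK (pathwise `N`-uniform time modulus of the
mollified empirical density, driven by the conserved kinetic energy only) + a finite `(s, x)`-grid.

## What the reshape changed (composition idea unchanged)

* Every registered stub is now stated over TREE vocabulary only (`DensityCapNegative.{cone, mollDensity, capEvent,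
  CapLimit}`, `configEnergy`, `empiricalDensityField`, `HardSphereFlow`, `Torus.euclidDist`), so that each stub lands
  verbatim as a `Theorems/JParityClosureDensityCap<Stub>.lean` file (the local `Prop` abbreviations `kinEnergy`,
  `ClockBound`, `DensityModulus`, `DensityLLNUpTo` of the planner's skeleton are kept below only as documentation /
  glue and appear in NO stub signature).
* `stub_clock` is split into its trajectory part `stub_meanDisplacement` (mean minimal-image displacement along a good
  orbit `≤ √(2K/n)·|s'−s|` — the general transport clock of the sibling card `weak-lln-upgrade`) and the kernel glue
  (`3/(πr⁴)`-Lipschitz cone; proved by the lead inside the assembly of `stub_gridUpgrade`).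
* `stub_gridUpgrade` is split into the SURE inclusion at fixed `N` (`stub_capEventSubset`: on `good ∩ {K̄_N ≤ K}` the
  overshoot event lies in a finite union of fixed-time grid deviation events) and the measure-theoretic assembly
  (`stub_gridUpgrade`: nets, energy tightness, union bound on the outer measure, `Tendsto ⇒ ∃ N₀`), which consumes
  `stub_meanDisplacement` and `stub_capEventSubset`.

## Registered stubs (the ONLY `sorry`s of the file)

* `stub_meanDisplacement` (A, worker) · `stub_eulerDensityModulus` (B, worker) · `stub_capEventSubset` (D, worker) ·
  `stub_gridUpgrade` (E, lead).

## Sorry-free glue proved here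

`localGibbsLaw_compl_good` (bad set null), `energyTight_of_tie` (χ ≡ 1 energy instance of the tie ⇒
`P(∫E(0)+1 < K̄_N) → 0`), the dock `densityLLNUpTo_of_band`, the composition `DensityCap_of`, the corollary
`densityCap_of_hydrodynamicLimit` (Disproof §6 near-miss, now modulo the same stubs), and the deflated transfer
`slabClosure_iff_hydroLimitInBand`.

## Composition (audited): `DensityCap_of (hB : ImplosionDichotomy.HydroLimitInBand) (hD : JParityClosure.DiluteSelfConsistency) : JParityClosure.DensityCap`

Hypotheses are ROUTE ITEMS by name (stmt-9133, stmt-3091) — the honest dock all three triagers accepted; the crux is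
EQUIVALENT to the density third of the conjunct (converse = card `equal-mass-two-sided-dock`; unguarded surplus =
`packingBandAt_of_densityCap`, Disproof §8), so no cheaper non-circular input exists.

## Disproof.lean (cdisprove cycles 1–2) honoured

`densityCap_false_untied`: the tie `h0` is consumed by the dock and by `energyTight_of_tie`; `densityCap_false_noPDE`:
`hE` is consumed by the dock; no stub asserts a cap for untied or non-PDE fields (`stub_eulerDensityModulus` uses only
continuity of `ρ`). `not_densityCapSwapped` / `not_densityCapAllN`: every statement is `∃ N₀ ∀ N ≥ N₀` at FIXED `r`;
the one pathwise object is a time-MODULUS (constant `∝ r⁻⁴`), never a sure bound. §8 (cycle 2,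
`DenseExcursionAbovePacking → ¬DensityCap`): concerns the UNGUARDED surplus, carried here entirely by `hD` (3091).
-/

noncomputable section

namespace Summit.AtomisticToContinuum.HydrodynamicLimit.Cruxes.DensityCap.LipschitzClockFreePastCap

open MeasureTheory Filter Set Topology
open scoped ENNReal BigOperators
open Literature.MathematicalPhysics.KineticTheory Literature.Analysis.FluidPDE
open Literature.Analysis.FunctionSpaces (Torus.IsSmoothSpaceTimeOn)
open Summit.AtomisticToContinuum.HydrodynamicLimit.Theorems.DensityCapNegative
  (cone mollDensity capEvent CapLimit densityCap_iff mollDensity_le mollDensity_eq cone_nonneg cone_le)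
open Summit.AtomisticToContinuum.HydrodynamicLimit.Theorems.PolynomialCompressionPDE (Flows)

/-! ## §0 Vocabulary of the line (documentation / glue only — no stub signature uses these) -/

/-- The torus hard-sphere geometry in dimension `3`. -/
abbrev G3 : Geometry (Fin 3) T3 := Torus.geometry (Fin 3)

/-- Kinetic energy PER PARTICLE of a configuration, `n⁻¹ · ½ ∑ᵢ |vᵢ|²`; conserved along hard-sphere trajectories. -/
def kinEnergy {n : ℕ} (w : Config n (Fin 3) T3) : ℝ :=
  (n : ℝ)⁻¹ * configEnergy w

/-- THE CLOCK of one hard-sphere flow `Ψ` on `𝕋³`: along every good orbit the `r`-mollified empirical density read at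
any centre is Lipschitz in time with the `N`-uniform constant `3/(π r⁴) · √(2 K(z))`. (Derived in the lead's
assembly from `stub_meanDisplacement` and the `3/(πr⁴)`-Lipschitz bound of the cone kernel.) -/
def ClockBound {ε : ℝ} {n : ℕ} (Ψ : HardSphereFlow G3 ε n) : Prop :=
  ∀ r : ℝ, 0 < r → ∀ z ∈ Ψ.good, ∀ (s s' : ℝ) (x₀ : T3),
    |mollDensity r (Ψ.flow s' z) x₀ - mollDensity r (Ψ.flow s z) x₀| ≤
      3 / (Real.pi * r ^ 4) * Real.sqrt (2 * kinEnergy z) * |s' - s|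

/-- Uniform-continuity package of a density field `ρ` on the slab `[0, t] × 𝕋³` (minimal-image metric in `x`). -/
def DensityModulus (ρ : ℝ → T3 → ℝ) (t : ℝ) : Prop :=
  ∀ η : ℝ, 0 < η → ∃ r₀ : ℝ, 0 < r₀ ∧ r₀ ≤ 1 / 2 ∧
    (∀ r : ℝ, 0 < r → r < r₀ → ∀ s ∈ Icc 0 t, ∀ x : T3, ∫ y, cone r y x * ρ s y ≤ ρ s x + η) ∧
    ∃ τ₀ : ℝ, 0 < τ₀ ∧ ∀ s ∈ Icc 0 t, ∀ s' ∈ Icc 0 t, |s - s'| ≤ τ₀ →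
      ∀ x x' : T3, Torus.euclidDist x x' ≤ r₀ → |ρ s x - ρ s' x'| ≤ η

/-- The FIXED-TIME density law of large numbers at every `s ∈ [0, t]`, for laws `P N` and flows `Φ N`. -/
def DensityLLNUpTo (P : (N : ℕ) → Measure (Config (N + 1) (Fin 3) T3)) {σ : ℝ} (Φ : Flows σ)
    (ρ : ℝ → T3 → ℝ) (t : ℝ) : Prop :=
  ∀ s ∈ Icc 0 t, ∀ χ : T3 → ℝ, Continuous χ → ∀ δ : ℝ, 0 < δ →
    Tendsto (fun N => P N {z | δ < |empiricalDensityField ((Φ N).flow s z) χ - ∫ x, χ x * ρ s x|})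
      atTop (𝓝 0)

/-! ## §1 Registered stubs (`sorry` only here; tree vocabulary only) -/

/-- **STUB A — mean displacement bound** (the trajectory half of the Lipschitz clock; size M). Along the orbit of a
good point of ANY hard-sphere flow on `𝕋³` (any diameter `ε`, any `n`, all real times), the mean minimal-image
displacement of the particles between times `s` and `s'` is at most `√(2K/n) · |s' − s|`, `K = configEnergy z`
(`√(2K/n)` = quadratic-mean speed, conserved). Route: `f(τ) := n⁻¹ ∑ᵢ d(xᵢ(τ), xᵢ(s))` is continuous
(`pos_continuous`, `Torus.continuous_euclidDist`); at every `τ` there is a collision-free `(τ, u)`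
(`exists_Ioo_right_free`) on which the orbit is free flight from `γ τ` (`eq_freeFlight_of_Ioo_free`), so for
`τ' ∈ [τ, u)`: `f(τ') − f(τ) ≤ n⁻¹∑ᵢ d(xᵢ(τ'), xᵢ(τ)) ≤ (τ'−τ) n⁻¹∑ᵢ‖vᵢ(τ)‖ ≤ (τ'−τ)√(2K(γ τ)/n) = (τ'−τ)√(2K(z)/n)`
(`euclidDist_triangle`, `euclidDist_translate_le x x a 0`, Cauchy–Schwarz, `configEnergy_eq_holds` + `flow_zero`); the
fencing lemma `image_le_of_liminf_slope_right_le_deriv_boundary` (B(τ) = √(2K/n)(τ − s)) gives the bound on `[s, s']`;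
`s' < s` by symmetry of `euclidDist`. `n = 0`: both sides `0`. -/
theorem stub_meanDisplacement {ε : ℝ} {n : ℕ} (Ψ : HardSphereFlow (Torus.geometry (Fin 3)) ε n)
    {z : Config n (Fin 3) T3} (hz : z ∈ Ψ.good) (s s' : ℝ) :
    (n : ℝ)⁻¹ * ∑ i, Torus.euclidDist ((Ψ.flow s' z i).1) ((Ψ.flow s z i).1) ≤
      Real.sqrt (2 * ((n : ℝ)⁻¹ * configEnergy z)) * |s' - s| := by
  sorry

/-- **STUB B — modulus of the Euler density** (size M). For a field `ρ` jointly smooth on `[0, T) × 𝕋³`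
(`IsHardSphereEulerSolution.smooth_density`) and `t < T`: for every `η > 0` a radius `r₀ ≤ 1/2` with (i)
`∫ cone r y x · ρ s y dy ≤ ρ s x + η` for all `r ∈ (0, r₀)`, `s ∈ [0, t]`, `x`, and (ii) a joint modulus
`|ρ s x − ρ s' x'| ≤ η` for `|s − s'| ≤ τ₀`, `euclidDist x x' ≤ r₀` (`s, s' ∈ [0, t]`). Route: the space–time lift
`stLift ρ` is continuous on `Ico 0 T ×ˢ univ` (`IsSmoothSpaceTimeOn.continuousOn_stLift`), hence uniformly continuous on
the compact `Icc 0 t ×ˢ closedBall 0 2` (`IsCompact.uniformContinuousOn_of_continuous`); for `x, x'` lift to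
`ỹ := reprSym x` (`‖ỹ‖ ≤ √3/2`, `norm_reprSym_le_holds`) and `ỹ' := ỹ + reprSym (x' − x)` (`proj ỹ' = x'` by
`proj_add`/`proj_reprSym`, `‖ỹ' − ỹ‖ = euclidDist x' x`) ⇒ (ii); (i) from (ii) at equal times, `cone ≥ 0`,
`cone r y x = 0` unless `euclidDist y x < r`, `∫ cone r y x dy = 1` (`integral_cone` + `euclidDist_comm` +
`coneMass_eq_one`, `r ≤ 1/2`). Only CONTINUITY of `ρ` is used — no balance law, no cap is claimed. -/
theorem stub_eulerDensityModulus {T : ℝ} {ρ : ℝ → T3 → ℝ}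
    (hρ : Torus.IsSmoothSpaceTimeOn (Ico 0 T) ρ) {t : ℝ} (ht : t ∈ Ico 0 T) :
    ∀ η : ℝ, 0 < η → ∃ r₀ : ℝ, 0 < r₀ ∧ r₀ ≤ 1 / 2 ∧
      (∀ r : ℝ, 0 < r → r < r₀ → ∀ s ∈ Icc 0 t, ∀ x : T3, ∫ y, cone r y x * ρ s y ≤ ρ s x + η) ∧
      ∃ τ₀ : ℝ, 0 < τ₀ ∧ ∀ s ∈ Icc 0 t, ∀ s' ∈ Icc 0 t, |s - s'| ≤ τ₀ →
        ∀ x x' : T3, Torus.euclidDist x x' ≤ r₀ → |ρ s x - ρ s' x'| ≤ η := by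
  sorry

/-- **STUB D — the sure inclusion at fixed `N`** (pure `ε/4`-bookkeeping; size M). For ONE hard-sphere flow `Ψ`
(any `ε`, `n`), a field `ρ`, `t, η`, a radius `r > 0` with: the clock along good orbits (constant
`3/(πr⁴)·√(2K̄(z))`, `K̄ = n⁻¹·configEnergy`), the centre-Lipschitz bound of the mollified density, the Euler-side
bounds (i) `∫ cone r y x ρ(s,y)dy ≤ ρ(s,x) + η/4` and (ii) the joint modulus `η/4` at scales `(τ₀, r₀)`, a finite
`x`-net `Sx` of mesh `δx ≤ r₀` with `3/(πr⁴)·δx ≤ η/8`, a finite time net `St ⊆ [0,t]` of mesh `δt ≤ τ₀` with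
`3/(πr⁴)·√(2K)·δt ≤ η/8`: every GOOD configuration with `K̄(z) ≤ K` in the overshoot event
`{∃ s ∈ [0,t], ∃ x, ρ s x + η < ρ̄ʳ(Ψ_s z)(x)}` lies in some grid deviation event
`{η/4 < |empiricalDensityField (Ψ_{s_k} z) (cone r · x_l) − ∫ cone r y x_l ρ(s_k,y) dy|}`.
Proof: pick `s_k, x_l` near `(s, x)`; `ρ̄ʳ(Ψ_{s_k}z)(x_l) ≥ ρ̄ʳ(Ψ_s z)(x) − η/8 − η/8 > ρ(s,x) + 3η/4 ≥ ρ(s_k,x_l) + η/2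
≥ ∫cone·ρ(s_k) + η/4`, and `empiricalDensityField w (cone r · x_l) = mollDensity r w x_l` (`rfl`). -/
theorem stub_capEventSubset {ε : ℝ} {n : ℕ} (Ψ : HardSphereFlow (Torus.geometry (Fin 3)) ε n)
    (ρ : ℝ → T3 → ℝ) {t η r r₀ τ₀ K δx δt : ℝ} (hr : 0 < r)
    (hclock : ∀ z ∈ Ψ.good, ∀ (s s' : ℝ) (x₀ : T3),
      |mollDensity r (Ψ.flow s' z) x₀ - mollDensity r (Ψ.flow s z) x₀| ≤
        3 / (Real.pi * r ^ 4) * Real.sqrt (2 * ((n : ℝ)⁻¹ * configEnergy z)) * |s' - s|)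
    (hlip : ∀ (w : Config n (Fin 3) T3) (x x' : T3),
      |mollDensity r w x - mollDensity r w x'| ≤ 3 / (Real.pi * r ^ 4) * Torus.euclidDist x x')
    (hmod1 : ∀ s ∈ Icc 0 t, ∀ x : T3, ∫ y, cone r y x * ρ s y ≤ ρ s x + η / 4)
    (hmod2 : ∀ s ∈ Icc 0 t, ∀ s' ∈ Icc 0 t, |s - s'| ≤ τ₀ →
      ∀ x x' : T3, Torus.euclidDist x x' ≤ r₀ → |ρ s x - ρ s' x'| ≤ η / 4)
    (Sx : Finset T3) (hSx : ∀ x : T3, ∃ x' ∈ Sx, Torus.euclidDist x x' ≤ δx)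
    (hδx₁ : δx ≤ r₀) (hδx₂ : 3 / (Real.pi * r ^ 4) * δx ≤ η / 8)
    (St : Finset ℝ) (hSt : ∀ s ∈ St, s ∈ Icc 0 t) (hSt' : ∀ s ∈ Icc 0 t, ∃ s' ∈ St, |s - s'| ≤ δt)
    (hδt₁ : δt ≤ τ₀) (hδt₂ : 3 / (Real.pi * r ^ 4) * Real.sqrt (2 * K) * δt ≤ η / 8) :
    {z | ∃ s ∈ Icc 0 t, ∃ x : T3, ρ s x + η < mollDensity r (Ψ.flow s z) x} ∩ Ψ.good ∩
        {z | (n : ℝ)⁻¹ * configEnergy z ≤ K} ⊆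
      ⋃ s ∈ St, ⋃ x ∈ Sx, {z | η / 4 < |empiricalDensityField (Ψ.flow s z) (fun y => cone r y x) -
        ∫ y, cone r y x * ρ s y|} := by
  sorry

/-- **STUB E — the finite-grid upgrade, measure-theoretic assembly** (lead; size M). Given, for the flow family
`Φ`, the mean displacement bound along good orbits (STUB A per `N`), tightness `P_N(K < K̄_N) → 0` of the kinetic
energy per particle, the density modulus of `ρ` on `[0, t]` (STUB B's conclusion) and the fixed-time density LLN at
every `s ∈ [0, t]`, the crux's conclusion block `CapLimit σ a₀ u₀ θ₀ Φ ρ t` holds: for `η, δ` take `r₀, τ₀` from the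
modulus at `η/4`; for `r < r₀` the clock (A + `3/(πr⁴)`-Lipschitz cone), finite nets of `𝕋³`
(`finite_cover_balls_of_compact` + `euclidDist_le_holds`) and of `[0, t]`, STUB D's inclusion
`capEvent ⊆ goodᶜ ∪ {K < K̄} ∪ ⋃ grid events`, `goodᶜ` null (`localGibbsLaw_compl_good`), each grid event `→ 0` by the
LLN at `s_k` with the continuous test `cone r · x_l`, finite union bound on the outer measure, `tendsto_finset_sum`,
`Tendsto.eventually_lt_const` ⇒ `N₀`. -/
theorem stub_gridUpgrade {σ : ℝ} (a₀ θ₀ : T3 → ℝ) (u₀ : T3 → V3) (Φ : Flows σ) (ρ : ℝ → T3 → ℝ)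
    {t : ℝ} (ht : 0 ≤ t)
    (hdisp : ∀ N : ℕ, ∀ z ∈ (Φ N).good, ∀ s s' : ℝ,
      ((N + 1 : ℕ) : ℝ)⁻¹ * ∑ i, Torus.euclidDist (((Φ N).flow s' z i).1) (((Φ N).flow s z i).1) ≤
        Real.sqrt (2 * (((N + 1 : ℕ) : ℝ)⁻¹ * configEnergy z)) * |s' - s|)
    {K : ℝ}
    (hK : Tendsto (fun N => localGibbsLaw σ a₀ u₀ θ₀ N (Φ N)
      {z | K < ((N + 1 : ℕ) : ℝ)⁻¹ * configEnergy z}) atTop (𝓝 0))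
    (hmod : ∀ η : ℝ, 0 < η → ∃ r₀ : ℝ, 0 < r₀ ∧ r₀ ≤ 1 / 2 ∧
      (∀ r : ℝ, 0 < r → r < r₀ → ∀ s ∈ Icc 0 t, ∀ x : T3, ∫ y, cone r y x * ρ s y ≤ ρ s x + η) ∧
      ∃ τ₀ : ℝ, 0 < τ₀ ∧ ∀ s ∈ Icc 0 t, ∀ s' ∈ Icc 0 t, |s - s'| ≤ τ₀ →
        ∀ x x' : T3, Torus.euclidDist x x' ≤ r₀ → |ρ s x - ρ s' x'| ≤ η)
    (hlln : ∀ s ∈ Icc 0 t, ∀ χ : T3 → ℝ, Continuous χ → ∀ δ : ℝ, 0 < δ →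
      Tendsto (fun N => localGibbsLaw σ a₀ u₀ θ₀ N (Φ N)
        {z | δ < |empiricalDensityField ((Φ N).flow s z) χ - ∫ x, χ x * ρ s x|}) atTop (𝓝 0)) :
    CapLimit σ a₀ u₀ θ₀ Φ ρ t := by
  sorry

/-! ## §2 Glue (sorry-free) -/

/-- Kinetic energy per particle = the empirical energy field tested against `χ ≡ 1`. -/
theorem kinEnergy_eq_empiricalEnergyField {n : ℕ} (w : Config n (Fin 3) T3) :
    kinEnergy w = empiricalEnergyField w (fun _ => 1) := by
  unfold kinEnergy empiricalEnergyField configEnergy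
  rw [integral_empiricalMeasure]
  congr 1
  rw [Finset.mul_sum]
  refine Finset.sum_congr rfl fun i _ => ?_
  ring

/-- The bad set of a flow is null for the local Gibbs law (the law is absolutely continuous w.r.t. Liouville). -/
theorem localGibbsLaw_compl_good (σ : ℝ) (a₀ θ₀ : T3 → ℝ) (u₀ : T3 → V3) (N : ℕ)
    (Ψ : HardSphereFlow G3 (hsDiameter σ N) (N + 1)) :
    localGibbsLaw σ a₀ u₀ θ₀ N Ψ Ψ.goodᶜ = 0 := by
  have hL : localGibbsLaw σ a₀ u₀ θ₀ N Ψ =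
      (liouville G3 (N + 1) (hsDiameter σ N)).withDensity fun z => ENNReal.ofReal
        (canonicalDensity G3 (hsDiameter σ N) (N + 1) (localGibbsProfile a₀ u₀ θ₀) z) := rfl
  rw [hL]
  exact withDensity_absolutelyContinuous _ _ Ψ.measure_compl_good

/-- **Energy tightness from the tie** (the `χ ≡ 1` energy instance of the `t = 0` law of large numbers): the
kinetic energy per particle exceeds `∫ E(0) + 1` only with vanishing probability. On the good set `Φ_0 = id` and
`empiricalEnergyField z 1 = kinEnergy z`; the bad set is null. -/
theorem energyTight_of_tie {σ : ℝ} {a₀ θ₀ : T3 → ℝ} {u₀ : T3 → V3} {ρ θ : ℝ → T3 → ℝ} {u : ℝ → T3 → V3}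
    (Φ : Flows σ) (h0 : TendstoHydroFieldsAt (fun N => localGibbsLaw σ a₀ u₀ θ₀ N (Φ N)) Φ ρ u θ 0) :
    Tendsto (fun N => localGibbsLaw σ a₀ u₀ θ₀ N (Φ N)
      {z | (∫ x, totalEnergyDensity (ρ 0 x) (u 0 x) (θ 0 x)) + 1 < kinEnergy z}) atTop (𝓝 0) := by
  set E₀ : ℝ := ∫ x, totalEnergyDensity (ρ 0 x) (u 0 x) (θ 0 x) with hE₀
  have h := (h0 (fun _ => (1 : ℝ)) continuous_const 1 one_pos).2.2
  have hE : (∫ x, (fun _ : T3 => (1 : ℝ)) x * totalEnergyDensity (ρ 0 x) (u 0 x) (θ 0 x)) = E₀ := by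
    simp only [one_mul, hE₀]
  refine tendsto_of_tendsto_of_tendsto_of_le_of_le tendsto_const_nhds h (fun _ => zero_le) fun N => ?_
  set P := localGibbsLaw σ a₀ u₀ θ₀ N (Φ N) with hP
  have hsub : {z : Config (N + 1) (Fin 3) T3 | E₀ + 1 < kinEnergy z} ⊆
      ({z | E₀ + 1 < kinEnergy z} ∩ (Φ N).good) ∪ (Φ N).goodᶜ := by
    intro z hz
    by_cases hg : z ∈ (Φ N).good
    · exact Or.inl ⟨hz, hg⟩
    · exact Or.inr hg
  have hincl : {z : Config (N + 1) (Fin 3) T3 | E₀ + 1 < kinEnergy z} ∩ (Φ N).good ⊆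
      {z | (1 : ℝ) < |empiricalEnergyField ((Φ N).flow 0 z) (fun _ => (1 : ℝ)) -
        ∫ x, (fun _ : T3 => (1 : ℝ)) x * totalEnergyDensity (ρ 0 x) (u 0 x) (θ 0 x)|} := by
    rintro z ⟨hz, hg⟩
    have hz' : E₀ + 1 < kinEnergy z := hz
    show (1 : ℝ) < |empiricalEnergyField ((Φ N).flow 0 z) (fun _ => (1 : ℝ)) -
        ∫ x, (fun _ : T3 => (1 : ℝ)) x * totalEnergyDensity (ρ 0 x) (u 0 x) (θ 0 x)|
    rw [(Φ N).flow_zero z hg, ← kinEnergy_eq_empiricalEnergyField, hE]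
    exact lt_of_lt_of_le (by linarith) (le_abs_self _)
  calc P {z | E₀ + 1 < kinEnergy z}
      ≤ P ({z | E₀ + 1 < kinEnergy z} ∩ (Φ N).good) + P (Φ N).goodᶜ :=
        (measure_mono hsub).trans (measure_union_le _ _)
    _ ≤ P {z | (1 : ℝ) < |empiricalEnergyField ((Φ N).flow 0 z) (fun _ => (1 : ℝ)) -
          ∫ x, (fun _ : T3 => (1 : ℝ)) x * totalEnergyDensity (ρ 0 x) (u 0 x) (θ 0 x)|} + 0 :=
        add_le_add (measure_mono hincl) (le_of_eq (localGibbsLaw_compl_good σ a₀ θ₀ u₀ N (Φ N)))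
    _ = _ := add_zero _

/-- **The dock** (pure logic): the packing-guarded band limit (stmt-9133) and dilute self-consistency (stmt-3091)
give the density LLN at every `s ≤ t < T` for every tied classical solution, `σ < min σ₁ σ₃`. -/
theorem densityLLNUpTo_of_band {η₀ : ℝ} {a₀ θ₀ : T3 → ℝ} {u₀ : T3 → V3} {σ₁ σ₃ σ : ℝ}
    (h1 : ∀ σ : ℝ, 0 < σ → σ < σ₁ → ∀ (T : ℝ) (ρ θ : ℝ → T3 → ℝ) (u : ℝ → T3 → V3),
      IsHardSphereEulerSolution σ T ρ u θ → (∀ t ∈ Ico 0 T, ∀ x, ρ t x * σ ^ 3 < η₀) →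
      ∀ Φ : Flows σ, TendstoHydroFieldsAt (fun N => localGibbsLaw σ a₀ u₀ θ₀ N (Φ N)) Φ ρ u θ 0 →
      ∀ t ∈ Ico 0 T, TendstoHydroFieldsAt (fun N => localGibbsLaw σ a₀ u₀ θ₀ N (Φ N)) Φ ρ u θ t)
    (h3 : ∀ σ : ℝ, 0 < σ → σ < σ₃ → ∀ (T : ℝ) (ρ θ : ℝ → T3 → ℝ) (u : ℝ → T3 → V3),
      IsHardSphereEulerSolution σ T ρ u θ →
      ∀ Φ : Flows σ, TendstoHydroFieldsAt (fun N => localGibbsLaw σ a₀ u₀ θ₀ N (Φ N)) Φ ρ u θ 0 →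
      ∀ t ∈ Ico 0 T, ∀ x, ρ t x * σ ^ 3 < η₀)
    (hσ : 0 < σ) (hσ1 : σ < σ₁) (hσ3 : σ < σ₃) {T : ℝ} {ρ θ : ℝ → T3 → ℝ} {u : ℝ → T3 → V3}
    (hE : IsHardSphereEulerSolution σ T ρ u θ) (Φ : Flows σ)
    (h0 : TendstoHydroFieldsAt (fun N => localGibbsLaw σ a₀ u₀ θ₀ N (Φ N)) Φ ρ u θ 0)
    {t : ℝ} (ht : t ∈ Ico 0 T) :
    DensityLLNUpTo (fun N => localGibbsLaw σ a₀ u₀ θ₀ N (Φ N)) Φ ρ t := by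
  intro s hs χ hχ δ hδ
  have hguard : ∀ t ∈ Ico 0 T, ∀ x, ρ t x * σ ^ 3 < η₀ := h3 σ hσ hσ3 T ρ θ u hE Φ h0
  exact (h1 σ hσ hσ1 T ρ θ u hE hguard Φ h0 s ⟨hs.1, lt_of_le_of_lt hs.2 ht.2⟩ χ hχ δ hδ).1

/-- **The cap for ONE tied classical solution from the density LLN on `[0, t]`** (the stubs composed; this is the
per-instance statement every dock shares): STUB E fed with STUB A (per `N`), the energy tightness of the tie, STUB B
and the fixed-time density LLN at every `s ≤ t`. -/
theorem capLimit_of_densityLLNUpTo {σ : ℝ} {a₀ θ₀ : T3 → ℝ} {u₀ : T3 → V3} {T : ℝ} {ρ θ : ℝ → T3 → ℝ}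
    {u : ℝ → T3 → V3} (hE : IsHardSphereEulerSolution σ T ρ u θ) (Φ : Flows σ)
    (h0 : TendstoHydroFieldsAt (fun N => localGibbsLaw σ a₀ u₀ θ₀ N (Φ N)) Φ ρ u θ 0)
    {t : ℝ} (ht : t ∈ Ico 0 T) (hlln : DensityLLNUpTo (fun N => localGibbsLaw σ a₀ u₀ θ₀ N (Φ N)) Φ ρ t) :
    CapLimit σ a₀ u₀ θ₀ Φ ρ t :=
  stub_gridUpgrade a₀ θ₀ u₀ Φ ρ ht.1 (fun N _ hz s s' => stub_meanDisplacement (Φ N) hz s s')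
    (energyTight_of_tie Φ h0) (stub_eulerDensityModulus hE.smooth_density ht) hlln

/-! ## §3 Composition (audited): the stubs + the dock give the crux BY NAME -/

/-- **`DensityCap` from the line `lipschitz-clock-free-past-cap`** (kernel-checked composition, no `sorry` of its
own): hypotheses = the route items `ImplosionDichotomy.HydroLimitInBand` (stmt-9133) and
`JParityClosure.DiluteSelfConsistency` (stmt-3091); per profile `σ₀ := min σ₁ σ₃`; for a tied classical solution and
`t < T` the dock gives the density LLN on `[0, t]`, and `capLimit_of_densityLLNUpTo` the uniform-in-`(s, x)` cap
(`CapLimit`, definitionally the crux's conclusion block: `densityCap_iff`). -/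
theorem DensityCap_of (hB : Theses.ImplosionDichotomy.HydroLimitInBand)
    (hD : Theses.JParityClosure.DiluteSelfConsistency) : Theses.JParityClosure.DensityCap := by
  refine densityCap_iff.2 ?_
  intro a₀ θ₀ u₀ ha hθ hu ha0 hθ0
  obtain ⟨η₀, hη₀, hIB⟩ := hB
  obtain ⟨σ₁, hσ₁, h1⟩ := hIB a₀ θ₀ u₀ ha hθ hu ha0 hθ0
  obtain ⟨σ₃, hσ₃, h3⟩ := hD η₀ hη₀ a₀ θ₀ u₀ ha hθ hu ha0 hθ0
  refine ⟨min σ₁ σ₃, lt_min hσ₁ hσ₃, ?_⟩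
  intro σ hσ hσlt T ρ θ u hE Φ h0 t ht
  have hσ1 : σ < σ₁ := lt_of_lt_of_le hσlt (min_le_left _ _)
  have hσ3 : σ < σ₃ := lt_of_lt_of_le hσlt (min_le_right _ _)
  exact capLimit_of_densityLLNUpTo hE Φ h0 ht (densityLLNUpTo_of_band h1 h3 hσ hσ1 hσ3 hE Φ h0 ht)

/-- **The corollary status of the crux** (Disproof §6 near-miss `densityCap_of_hydrodynamicLimit`, now proved modulo
the same registered stubs): the summit conjunct gives the fixed-time LLN at every `s < T` unguarded, hence the cap. -/
theorem densityCap_of_hydrodynamicLimit (hHL : _root_.HydrodynamicLimit) : Theses.JParityClosure.DensityCap := by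
  refine densityCap_iff.2 ?_
  intro a₀ θ₀ u₀ ha hθ hu ha0 hθ0
  obtain ⟨σ₀, hσ₀, hHL⟩ := hHL a₀ θ₀ u₀ ha hθ hu ha0 hθ0
  refine ⟨σ₀, hσ₀, ?_⟩
  intro σ hσ hσlt T ρ θ u hE Φ h0 t ht
  refine capLimit_of_densityLLNUpTo hE Φ h0 ht ?_
  intro s hs χ hχ δ hδ
  exact (hHL σ hσ hσlt T ρ θ u hE Φ h0 s ⟨hs.1, lt_of_le_of_lt hs.2 ht.2⟩ χ hχ δ hδ).1

/-! ## §4 The card's transfer `SlabClosure` — recorded and DEFLATED (both directions proved; not a stub) -/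

/-- "The packing at scale `r` stayed below `ηb` on `[0, s]`, with high probability, eventually in `N`." -/
def PackingCapUpTo (σ r ηb s : ℝ) (a₀ θ₀ : T3 → ℝ) (u₀ : T3 → V3) (Φ : Flows σ) : Prop :=
  ∀ δ : ℝ, 0 < δ → ∃ N₀ : ℕ, ∀ N : ℕ, N₀ ≤ N →
    localGibbsLaw σ a₀ u₀ θ₀ N (Φ N)
      {z | ∃ s' ∈ Icc 0 s, ∃ x : T3, ηb < σ ^ 3 * mollDensity r ((Φ N).flow s' z) x} ≤ ENNReal.ofReal δ

/-- The card's transfer `C⁺`: the band statement with guard `ρσ³ < η₀/4`, concluded one time `s` at a time, under the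
extra hypothesis that the packing at ONE fixed macroscopic scale `r̄ ∈ (0, 1/2)` stayed `≤ η₀/2` on `[0, s]`. -/
def SlabClosure : Prop :=
  ∃ η₀ : ℝ, 0 < η₀ ∧ ∀ (a₀ θ₀ : T3 → ℝ) (u₀ : T3 → V3), Continuous a₀ → Continuous θ₀ → Continuous u₀ →
    (∀ x, 0 < a₀ x) → (∀ x, 0 < θ₀ x) →
    ∃ σ₀ : ℝ, 0 < σ₀ ∧ ∀ σ : ℝ, 0 < σ → σ < σ₀ →
      ∀ (T : ℝ) (ρ θ : ℝ → T3 → ℝ) (u : ℝ → T3 → V3), IsHardSphereEulerSolution σ T ρ u θ →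
        (∀ t ∈ Ico 0 T, ∀ x, ρ t x * σ ^ 3 < η₀ / 4) →
        ∀ Φ : Flows σ, TendstoHydroFieldsAt (fun N => localGibbsLaw σ a₀ u₀ θ₀ N (Φ N)) Φ ρ u θ 0 →
          ∀ r : ℝ, 0 < r → r < 1 / 2 → ∀ s ∈ Ico 0 T,
            PackingCapUpTo σ r (η₀ / 2) s a₀ θ₀ u₀ Φ →
              TendstoHydroFieldsAt (fun N => localGibbsLaw σ a₀ u₀ θ₀ N (Φ N)) Φ ρ u θ s

/-- `9133 → C⁺` (ignore the extra hypothesis; band `4η₀`). -/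
theorem slabClosure_of_hydroLimitInBand (h : Theses.ImplosionDichotomy.HydroLimitInBand) : SlabClosure := by
  obtain ⟨η₀, hη₀, h⟩ := h
  refine ⟨4 * η₀, by positivity, ?_⟩
  intro a₀ θ₀ u₀ ha hθ hu ha0 hθ0
  obtain ⟨σ₀, hσ₀, hσ⟩ := h a₀ θ₀ u₀ ha hθ hu ha0 hθ0
  refine ⟨σ₀, hσ₀, ?_⟩
  intro σ hσp hσlt T ρ θ u hE hguard Φ h0 r _hr _hr2 s hs _hcap
  have hguard' : ∀ t ∈ Ico 0 T, ∀ x, ρ t x * σ ^ 3 < η₀ := by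
    intro t ht x
    have := hguard t ht x
    linarith
  exact hσ σ hσp hσlt T ρ θ u hE hguard' Φ h0 s hs

/-- At a fixed scale `r` the past packing cap is SURE, hence holds in probability with `N₀ = 0`, as soon as
`σ³ · 3/(π r³) ≤ ηb` (`mollDensity_le`: `ρ̄ʳ ≤ 3/(π r³)` for every configuration). -/
theorem packingCapUpTo_of_small {σ r ηb s : ℝ} (hr : 0 < r) (hσ : 0 ≤ σ)
    (hsmall : σ ^ 3 * (3 / (Real.pi * r ^ 3)) ≤ ηb) (a₀ θ₀ : T3 → ℝ) (u₀ : T3 → V3) (Φ : Flows σ) :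
    PackingCapUpTo σ r ηb s a₀ θ₀ u₀ Φ := by
  intro δ _hδ
  refine ⟨0, fun N _ => ?_⟩
  have hempty : {z : Config (N + 1) (Fin 3) T3 |
      ∃ s' ∈ Icc 0 s, ∃ x : T3, ηb < σ ^ 3 * mollDensity r ((Φ N).flow s' z) x} = ∅ := by
    refine Set.eq_empty_of_forall_notMem fun z hz => ?_
    obtain ⟨s', -, x, hx⟩ := hz
    have hle : σ ^ 3 * mollDensity r ((Φ N).flow s' z) x ≤ σ ^ 3 * (3 / (Real.pi * r ^ 3)) :=
      mul_le_mul_of_nonneg_left (mollDensity_le hr _ _) (pow_nonneg hσ 3)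
    linarith
  rw [hempty, measure_empty]
  exact zero_le

/-- `C⁺ → 9133` WITHOUT DYNAMICS (triage r1-2, re-proved): take the band `η₀/4`, shrink `σ₀` below `1 ∧ πη₀/384` and
invoke `SlabClosure` at the fixed scale `r̄ = 1/4`, where the cap `≤ η₀/2` is sure (`σ³ · 192/π ≤ η₀/2`). -/
theorem hydroLimitInBand_of_slabClosure (h : SlabClosure) : Theses.ImplosionDichotomy.HydroLimitInBand := by
  obtain ⟨η₀, hη₀, h⟩ := h
  refine ⟨η₀ / 4, by positivity, ?_⟩
  intro a₀ θ₀ u₀ ha hθ hu ha0 hθ0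
  obtain ⟨σ₀, hσ₀, hσ⟩ := h a₀ θ₀ u₀ ha hθ hu ha0 hθ0
  refine ⟨min σ₀ (min 1 (Real.pi * η₀ / 384)), lt_min hσ₀ (lt_min one_pos (by positivity)), ?_⟩
  intro σ hσp hσlt T ρ θ u hE hguard Φ h0 t ht
  have hσ0 : σ < σ₀ := lt_of_lt_of_le hσlt (min_le_left _ _)
  have hσ1 : σ < 1 := lt_of_lt_of_le hσlt ((min_le_right _ _).trans (min_le_left _ _))
  have hσc : σ < Real.pi * η₀ / 384 := lt_of_lt_of_le hσlt ((min_le_right _ _).trans (min_le_right _ _))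
  have hpi : 0 < Real.pi := Real.pi_pos
  have hsmall : σ ^ 3 * (3 / (Real.pi * (1 / 4 : ℝ) ^ 3)) ≤ η₀ / 2 := by
    have hσ3 : σ ^ 3 ≤ σ := pow_le_of_le_one hσp.le hσ1.le three_ne_zero
    have h192 : 3 / (Real.pi * (1 / 4 : ℝ) ^ 3) = 192 / Real.pi := by
      field_simp
      norm_num
    rw [h192]
    calc σ ^ 3 * (192 / Real.pi) ≤ σ * (192 / Real.pi) := by gcongr
      _ ≤ Real.pi * η₀ / 384 * (192 / Real.pi) := by gcongr
      _ = η₀ / 2 := by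
          field_simp
          ring
  exact hσ σ hσp hσ0 T ρ θ u hE hguard Φ h0 (1 / 4) (by norm_num) (by norm_num) t ht
    (packingCapUpTo_of_small (by norm_num) hσp.le hsmall a₀ θ₀ u₀ Φ)

/-- The transfer is EXACTLY the shared item stmt-9133. -/
theorem slabClosure_iff_hydroLimitInBand : SlabClosure ↔ Theses.ImplosionDichotomy.HydroLimitInBand :=
  ⟨hydroLimitInBand_of_slabClosure, slabClosure_of_hydroLimitInBand⟩

end Summit.AtomisticToContinuum.HydrodynamicLimit.Cruxes.DensityCap.LipschitzClockFreePastCap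

end
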